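import Summits.BirchSwinnertonDyer.BirchSwinnertonDyer.Theorems.TwoAdicConverseEulerCharKernelAtTwo
import Summits.BirchSwinnertonDyer.BirchSwinnertonDyer.Theorems.ByReductionTypeAtTwoTorsionEulerCharH46OddPrimes
import HarnessLib

set_option linter.dupNamespace false -- `…BirchSwinnertonDyer.BirchSwinnertonDyer…` is the cell's nested layout (D-0017)
set_option autoImplicit false

/-!
# Route `TwoAdicConverse` (rung S3), PUB item 19167 `OrdConversePublishedInputsAtTwo`: its Greenberg conjunct is KERNEL except on
# the (T₁)@2-violating rows — the exact residual PRINT content of `Greenberg1999.thm41_charValue_rankZero_anyPrime`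

Cell `bsd-2adic` (run/shared/lean/pub/bsd-2adic/), seat `bsd-2adic-conv-1` (GEN 37).  THEOREMS ONLY — no definition, no named fact, no
instance, no axiom, no `sorry`; `--supports stmt-BirchSwinnertonDyer-19218`.  HONEST FRAMING: PUB 19167 is a by-name conjunction of
PUBLISHED facts and stays so; nothing here asserts a printed fact; item 19218 stays OPEN; BSD is not proved by any of this.
PARTITION (D-0054): none — RANK axis (S3); companion formula cell X5@2 good-ord; TYPES the residual object of PUB 19167's third conjunct
as the sub-cell (β) ∖ (T₁)@2 («a nonzero rational `2`-power torsion point inside `E₁(ℚ̄₂)`»); closes none; nothing booked.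

WHAT.  PUB 19167 = modularity ∧ Kato 17.4 (1)(2)@2 ∧ `Greenberg1999.thm41_charValue_rankZero_anyPrime` (Greenberg, LNM 1716, Thm. 4.1
in rank `0` over `ℚ` at EVERY good ordinary prime).  After seat `bsd-2adic-tower-1` GEN 35 (p744164
`TorsionEulerChar.H46LevelZero.greenberg_charValue_rankZero_holds`: the ODD-prime fact is a THEOREM; p742465 `…twoAdicEulerCharRankZero_of_T1`)
and this seat's `TwoAdicEulerCharKernel` file (p746463: the `p = 2` display is a THEOREM for odd `#E(ℚ)_tors` and under the rational-point
form of (T₁)@2), the named fact FOLLOWS from its own restriction to the rows where (T₁)@2 FAILS: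

* §1 `twoClause_of_twoAdicEulerCharRankZero` — the display `X5.O1.TwoAdicEulerCharRankZero W 0` IS the `p = 2` clause of the fact at `W`
  (exponent `2^{ord₂ ∏ c_ℓ + 0}` ↦ `2^{ord₂ ∏ c_ℓ}`; `GoodOrd`/`IsOrdinaryAt` are the same conjunction).
* §2 ★ `thm41_charValue_rankZero_anyPrime_of_T1Residual (h)` — `thm41_charValue_rankZero_anyPrime` GIVEN ONLY `h`: the display for the
  globally minimal `W` that admit, at some place `v2 ∋ 2`, a rational point with `2`-power-torsion image mapping into the kernel of
  reduction and `≠ O` (stated as the negation of the rational-point form of (T₁)@2).  Odd `p`: tower-1's theorem; `p = 2` on (T₁)@2: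
  `TwoAdicEulerCharKernel.twoAdicEulerCharRankZero_of_ratPoints_T1`; the rest is `h`.  Also the coarser
  `thm41_charValue_rankZero_anyPrime_of_evenTorsion (h)` (`h` = the display for EVEN `#E(ℚ)_tors` only).
* §3 `ordConversePublishedInputsAtTwo_of_T1Residual (hmod) (h17) (h)` — the ROUTE decl `OrdConversePublishedInputsAtTwo` (item 19167, by
  name) from modularity, Kato 17.4 (1)(2)@2 and `h` alone.  Board sentence: «PUB 19167 = PRINT {modularity, Kato 17.4@2, Greenberg Thm 4.1
  AT 2 ON (β) ∖ (T₁)@2}»; the complement of that residual is kernel.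

References: [GreenbergLNM1716] Thm. 4.1 (p. 102), §4 Lemmas 4.6–4.7 (pp. 105–108); [SilvermanAEC2009] Prop. VII.3.1; [Kato2004Asterisque]
Thm. 17.4 (1)(2) (p. 273); [BCDTJAMS2001] Thm. A.
-/

noncomputable section

open scoped Classical MatrixGroups ModularForm NumberField

open CongruenceSubgroup WeierstrassCurve NumberField IsDedekindDomain Field
  Literature.NumberTheory.EllipticCurves Literature.NumberTheory.EllipticCurves.ModularForms
  Literature.NumberTheory.EllipticCurves.Rank1Residual Summit.BirchSwinnertonDyer.Rank1Residual.X5.O1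

namespace Summit.BirchSwinnertonDyer.BirchSwinnertonDyer.Theorems.TwoAdicEulerCharKernel

/-! ## §1 The display is the `p = 2` clause -/

/-- **The display `TwoAdicEulerCharRankZero W 0` gives the `p = 2` clause of Greenberg's parity-free Thm. 4.1 at `W`** (binders of
`Greenberg1999.thm41_charValue_rankZero_anyPrime_iff`'s second conjunct; `2^{(ord₂ ∏ c_ℓ : ℤ) + 0} = 2^{ord₂ ∏ c_ℓ}`).
[cite: GreenbergLNM1716, Thm. 4.1 (p. 102)] -/
theorem twoClause_of_twoAdicEulerCharRankZero (W : WeierstrassCurve ℚ) [W.IsElliptic] [W.IsGloballyMinimal]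
    (hEC : TwoAdicEulerCharRankZero W 0)
    (hgood : W.HasGoodReductionAtPrime 2) (hord : ¬ (2 : ℤ) ∣ W.frobeniusTrace 2)
    (κ : ZpExtension ℚ 2) (γ : Field.absoluteGaloisGroup ℚ)
    (hκ : κ.IsCyclotomic) (hγ : κ.IsTopGenerator γ) (hγ' : IsCyclotomicVariable 2 γ)
    (D : W.SelmerDualData κ γ) [Module.Finite (IwasawaAlgebra 2) D.X] (hX : D.IsTorsion)
    (fE : IwasawaAlgebra 2) (hfE : D.charIdeal = Ideal.span {fE}) (hfin : Finite (W.selmerGroupPInfty 2)) :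
    ∃ u : ℤ_[2]ˣ,
      ((PowerSeries.constantCoeff fE : ℤ_[2]) : ℚ_[2]) *
          (Nat.card (AddCommGroup.primaryComponent W.toAffine.Point 2) : ℚ_[2]) ^ 2 =
        ((u : ℤ_[2]) : ℚ_[2]) * (2 : ℚ_[2]) ^ (padicValNat 2 W.tamagawaProduct) *
          (Nat.card (AddCommGroup.primaryComponent
            ((integralModelInt W).map (Int.castRingHom (ZMod 2))).toAffine.Point 2) : ℚ_[2]) ^ 2 *
          (Nat.card (W.selmerGroupPInfty 2) : ℚ_[2]) := by
  have hgo : IsOrdinaryAt W 2 := ⟨hgood, hord⟩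
  obtain ⟨u, hu⟩ := hEC hgo κ γ hκ hγ hγ' D hX fE hfE hfin
  rw [add_zero, zpow_natCast] at hu
  exact ⟨u, hu⟩

/-! ## §2 The named fact from its (T₁)@2-residual -/

/-- **Greenberg's parity-free Thm. 4.1 (the named fact `thm41_charValue_rankZero_anyPrime`) FOLLOWS from its restriction to the
(T₁)@2-VIOLATING rows.**  Hypothesis `h`: the `p = 2` display for those globally minimal `W/ℚ` for which, at a place `v2 ∋ 2`, the
rational-point form of (T₁)@2 FAILS (some rational point with `2`-power-torsion image in `E(ℚ̄)` maps into the kernel of reduction at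
`v2` and is `≠ O`).  Everything else is kernel: odd `p` by tower-1's `greenberg_charValue_rankZero_holds` (p744164), `p = 2` on (T₁)@2 by
`twoAdicEulerCharRankZero_of_ratPoints_T1` (p746463 over p742465).  So the residual PRINT content of the fact is exactly Greenberg's
Thm. 4.1 at `2` on (β) ∖ (T₁)@2. [cite: GreenbergLNM1716, Thm. 4.1 (p. 102), §4 Lemmas 4.6–4.7 (pp. 105–108)] [cite: SilvermanAEC2009, Prop. VII.3.1] -/
theorem thm41_charValue_rankZero_anyPrime_of_T1Residual
    (h : ∀ (W : WeierstrassCurve ℚ) [W.IsElliptic] [W.IsGloballyMinimal]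
      (v2 : HeightOneSpectrum (𝓞 ℚ)), ((2 : ℕ) : 𝓞 ℚ) ∈ v2.asIdeal →
      ¬ (∀ P : W.toAffine.Point, (∃ t : ℕ, 2 ^ t • toGeomPoints W P = 0) →
          pointsMap W (v2.adicCompletion ℚ) (toGeomPoints W P) ∈ W.localKernelOfReduction v2 → P = 0) →
      TwoAdicEulerCharRankZero W 0) :
    Greenberg1999.thm41_charValue_rankZero_anyPrime := by
  refine Greenberg1999.thm41_charValue_rankZero_anyPrime_iff.mpr
    ⟨TorsionEulerChar.H46LevelZero.greenberg_charValue_rankZero_holds, ?_⟩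
  intro W _ _ hgood hord κ γ hκ hγ hγ' D _ hX fE hfE hfin
  obtain ⟨v2, hv2⟩ := exists_heightOneSpectrum_natCast_mem (K := ℚ) Nat.prime_two
  have hEC : TwoAdicEulerCharRankZero W 0 := by
    by_cases hT1 : ∀ P : W.toAffine.Point, (∃ t : ℕ, 2 ^ t • toGeomPoints W P = 0) →
        pointsMap W (v2.adicCompletion ℚ) (toGeomPoints W P) ∈ W.localKernelOfReduction v2 → P = 0
    · exact twoAdicEulerCharRankZero_of_ratPoints_T1 W v2 hv2 hT1
    · exact h W v2 hv2 hT1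
  exact twoClause_of_twoAdicEulerCharRankZero W hEC hgood hord κ γ hκ hγ hγ' D hX fE hfE hfin

/-- **Coarser form: the named fact from the display on EVEN `#E(ℚ)_tors` only** (odd `#E(ℚ)_tors` = (α) is kernel by
`twoAdicEulerCharRankZero_of_not_two_dvd_torsionOrder`). [cite: GreenbergLNM1716, Thm. 4.1 (p. 102)] -/
theorem thm41_charValue_rankZero_anyPrime_of_evenTorsion
    (h : ∀ (W : WeierstrassCurve ℚ) [W.IsElliptic] [W.IsGloballyMinimal], 2 ∣ W.torsionOrder → TwoAdicEulerCharRankZero W 0) :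
    Greenberg1999.thm41_charValue_rankZero_anyPrime := by
  refine Greenberg1999.thm41_charValue_rankZero_anyPrime_iff.mpr
    ⟨TorsionEulerChar.H46LevelZero.greenberg_charValue_rankZero_holds, ?_⟩
  intro W _ _ hgood hord κ γ hκ hγ hγ' D _ hX fE hfE hfin
  have hEC : TwoAdicEulerCharRankZero W 0 := by
    by_cases htors : 2 ∣ W.torsionOrder
    · exact h W htors
    · exact twoAdicEulerCharRankZero_of_not_two_dvd_torsionOrder W htors
  exact twoClause_of_twoAdicEulerCharRankZero W hEC hgood hord κ γ hκ hγ hγ' D hX fE hfE hfin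

/-! ## §3 PUB 19167 from modularity, Kato 17.4@2 and the (T₁)@2-residual alone -/

/-- **The route decl `OrdConversePublishedInputsAtTwo` (PUB item 19167, by name) from modularity, Kato 17.4 (1)(2)@2 and the
(T₁)@2-residual of Greenberg's Thm. 4.1 at `2`.**  Board sentence: PUB 19167 = PRINT {modularity, Kato 17.4@2, Greenberg 4.1 AT 2 ON
(β) ∖ (T₁)@2}.  A by-name re-packaging; the three inputs remain hypotheses (nothing printed is asserted).
[cite: BCDTJAMS2001, Thm. A] [cite: Kato2004Asterisque, Thm. 17.4 (1)(2) (p. 273)] [cite: GreenbergLNM1716, Thm. 4.1 (p. 102)] -/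
theorem ordConversePublishedInputsAtTwo_of_T1Residual
    (hmod : nonempty_modularParametrizationData)
    (h17 : ∀ (W : WeierstrassCurve ℚ) [W.IsElliptic] [W.IsGloballyMinimal]
      [NeZero (W.conductorNorm ℤ)] (f : CuspForm (Gamma0 (W.conductorNorm ℤ)) 2),
      kato_divisibility_allPrimes W 2 (f := f))
    (h : ∀ (W : WeierstrassCurve ℚ) [W.IsElliptic] [W.IsGloballyMinimal]
      (v2 : HeightOneSpectrum (𝓞 ℚ)), ((2 : ℕ) : 𝓞 ℚ) ∈ v2.asIdeal →
      ¬ (∀ P : W.toAffine.Point, (∃ t : ℕ, 2 ^ t • toGeomPoints W P = 0) →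
          pointsMap W (v2.adicCompletion ℚ) (toGeomPoints W P) ∈ W.localKernelOfReduction v2 → P = 0) →
      TwoAdicEulerCharRankZero W 0) :
    Summit.BirchSwinnertonDyer.BirchSwinnertonDyer.Theses.TwoAdicConverse.OrdConversePublishedInputsAtTwo :=
  ⟨hmod, fun W _ _ _ f => h17 W f, thm41_charValue_rankZero_anyPrime_of_T1Residual h⟩

/-- **Same, coarser: PUB 19167 from modularity, Kato 17.4@2 and the display on EVEN `#E(ℚ)_tors`.**
[cite: BCDTJAMS2001, Thm. A] [cite: Kato2004Asterisque, Thm. 17.4 (1)(2) (p. 273)] [cite: GreenbergLNM1716, Thm. 4.1 (p. 102)] -/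
theorem ordConversePublishedInputsAtTwo_of_evenTorsion
    (hmod : nonempty_modularParametrizationData)
    (h17 : ∀ (W : WeierstrassCurve ℚ) [W.IsElliptic] [W.IsGloballyMinimal]
      [NeZero (W.conductorNorm ℤ)] (f : CuspForm (Gamma0 (W.conductorNorm ℤ)) 2),
      kato_divisibility_allPrimes W 2 (f := f))
    (h : ∀ (W : WeierstrassCurve ℚ) [W.IsElliptic] [W.IsGloballyMinimal], 2 ∣ W.torsionOrder → TwoAdicEulerCharRankZero W 0) :
    Summit.BirchSwinnertonDyer.BirchSwinnertonDyer.Theses.TwoAdicConverse.OrdConversePublishedInputsAtTwo :=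
  ⟨hmod, fun W _ _ _ f => h17 W f, thm41_charValue_rankZero_anyPrime_of_evenTorsion h⟩

end Summit.BirchSwinnertonDyer.BirchSwinnertonDyer.Theorems.TwoAdicEulerCharKernel

end
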